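import Summits.CriticalPhenomena.PercolationContinuityZ3.Theorems.SoloInformedSlabBoxFace
import HarnessLib

/-!
# The exact cube is crossed face to face whenever `θ(p) > 0` (solo seat
`solo-CriticalPhenomena-informed`, paper §7b.3 (d6), portrait of the jump world)

The cube face (`SoloInformedCubeFace`) shows that `θ(p_c) > 0` forces every NEAR-cube
`[u,(r+1)u] × [0,(r+2)u]^{d-1}` to be crossed in its thin direction with probability `→ 1`.  For the
EXACT cube `Λ(L) = [-L, L]^d` nothing of the kind is available (the cube lemma produces crossings of
cubes in general position, not of a fixed grid cube), and this file records the one soft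
constraint there is: at every `p` with `θ(p) > 0`, and for every `L` and every direction `k`,

  `P_p(Λ(L) is crossed inside itself from its face {x_k = -L} to its face {x_k = L})
      ≥ (1 - (1 - θ(p))^{1/(2d)})²                                   (cubeCrossing_ge)`.

Proof (the square-root trick).  The `2d` increasing events `F_{k,ε} = {0 ↔ face (k,ε) in Λ(L)}`
are images of one another under signed coordinate permutations (`real_centreToFace_eq`); their
union contains `{Λ(0) ↔ ∂ⁱⁿΛ(L) in Λ(L)} ⊇ {0 ↔ ∞}` (`boxCrossing_zero_subset_iUnion_centreToFace`),
so Harris–FKG for the `2d` decreasing complements gives `(1 - P(F))^{2d} ≤ 1 - θ(p)`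
(`pow_compl_centreToFace_le`); and `F_{k,-1} ∩ F_{k,+1} ⊆ {face⁻ ↔ face⁺ in Λ(L)}` (both paths pass
through the centre), so Harris for the two increasing events gives `P(F)² ≤ P(cube crossed)`
(`sq_centreToFace_le_cubeCrossing`).  Consequence for the portrait (`cubeCrossing_ge_of_not_continuity`):
in the jump world `θ(p_c) > 0` the critical cube `Λ(L)` is crossed face to opposite face inside
itself with probability at least `c₀ = (1 - (1 - θ(p_c))^{1/2d})² > 0` for EVERY `L` — so the exact-cube
blocking probability is at most `1 - c₀`, but, unlike the near-cube blocking probability, it is not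
forced to tend to `0` by anything certified here.

References: T. E. Harris, Proc. Cambridge Philos. Soc. 56 (1960) 13–20 (Harris' inequality);
G. Grimmett, *Percolation*, 2nd ed., Springer 1999, Thm. (2.4) and the "square-root trick", §11.7
p. 317. [folklore]
-/

noncomputable section

namespace Summit.CriticalPhenomena.PercolationContinuityZ3.Theorems

open MeasureTheory ProbabilityTheory Filter Topology
open Literature.Probability.Percolation Literature.Probability.LatticeModels
open Literature.Probability.Percolation.CerfDembinVanishing
open scoped ENNReal

namespace SurfaceTension

variable {d : ℕ}

/-! ## Faces, centre-to-face events, the face-to-face crossing -/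

/-- The face of the cube `Λ(L)` in the signed direction `(k, ε)`: `{x ∈ Λ(L) : ε x_k = L}`. -/
def cubeFace (L : ℕ) (k : Fin d) (ε : ℤˣ) : Set (Site d) :=
  {x | x ∈ box d L ∧ (ε : ℤ) * x k = L}

/-- `F_{k,ε} = {face (k,ε) ↔ 0 in Λ(L)}`: the centre is joined to the face `(k, ε)` by an open path
inside the cube. -/
def centreToFace (L : ℕ) (k : Fin d) (ε : ℤˣ) : Set (BondConfig (Site d)) :=
  linked ↑(box d L) (cubeFace L k ε) {0}

/-- The cube `Λ(L)` is crossed inside itself, in direction `k`, from its face `{x_k = -L}` to its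
face `{x_k = L}`. -/
def cubeCrossing (L : ℕ) (k : Fin d) : Set (BondConfig (Site d)) :=
  linked ↑(box d L) (cubeFace L k (-1)) (cubeFace L k 1)

/-- `F_{k,ε}` is increasing. -/
theorem isUpperSet_centreToFace (L : ℕ) (k : Fin d) (ε : ℤˣ) :
    IsUpperSet (centreToFace (d := d) L k ε) :=
  isUpperSet_linked _ _ _

/-- `F_{k,ε}` is measurable. -/
theorem measurableSet_centreToFace (L : ℕ) (k : Fin d) (ε : ℤˣ) :
    MeasurableSet (centreToFace (d := d) L k ε) :=
  measurableSet_linked _ _ _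

/-- The face-to-face crossing is measurable. -/
theorem measurableSet_cubeCrossing (L : ℕ) (k : Fin d) :
    MeasurableSet (cubeCrossing (d := d) L k) :=
  measurableSet_linked _ _ _

/-! ## `{0 ↔ ∞}` lies in the union of the `2d` centre-to-face events -/

/-- A site of the inner boundary of `Λ(L)` lies on one of its `2d` faces. -/
theorem exists_cubeFace_of_mem_innerBoundary {L : ℕ} {a : Site d}
    (ha : a ∈ innerBoundary (zdGraph d) (box d L)) : ∃ (k : Fin d) (ε : ℤˣ), a ∈ cubeFace L k ε := by
  rw [mem_innerBoundary_iff] at ha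
  obtain ⟨habox, y, hy, hay⟩ := ha
  have habox' := mem_box.1 habox
  obtain ⟨k, hk⟩ : ∃ k, ¬ (-(L : ℤ) ≤ y k ∧ y k ≤ L) := by
    by_contra h
    push Not at h
    exact hy (mem_box.2 h)
  have h1 := coord_sub_le_one_of_adj hay k
  have hak := habox' k
  by_cases hyk : (L : ℤ) < y k
  · refine ⟨k, 1, habox, ?_⟩
    simp only [Units.val_one, one_mul]
    linarith [h1.2]
  · have hyk' : y k < -(L : ℤ) := by
      by_contra h'
      exact hk ⟨not_lt.1 h', not_lt.1 hyk⟩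
    refine ⟨k, -1, habox, ?_⟩
    simp only [Units.val_neg, Units.val_one, neg_mul, one_mul]
    linarith [h1.1]

/-- `{Λ(0) ↔ ∂ⁱⁿΛ(L) in Λ(L)} ⊆ ⋃_{k,ε} F_{k,ε}`. -/
theorem boxCrossing_zero_subset_iUnion_centreToFace (L : ℕ) :
    boxCrossing d 0 L ⊆ ⋃ k : Fin d, ⋃ ε : ℤˣ, centreToFace L k ε := by
  intro ω hω
  rw [boxCrossing_eq_linked, mem_linked_iff] at hω
  obtain ⟨a, ha, b, hb, hab⟩ := hω
  obtain ⟨k, ε, hak⟩ := exists_cubeFace_of_mem_innerBoundary (Finset.mem_coe.1 ha)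
  have hb0 : b = 0 := by
    have hb' := mem_box.1 (Finset.mem_coe.1 hb)
    funext j
    have := hb' j
    simp only [CharP.cast_eq_zero, neg_zero] at this
    simp only [Pi.zero_apply]
    omega
  subst hb0
  exact Set.mem_iUnion.2 ⟨k, Set.mem_iUnion.2 ⟨ε, mem_linked_iff.2 ⟨a, hak, 0, rfl, hab⟩⟩⟩

/-- `θ(p) ≤ P_p(Λ(0) ↔ ∂ⁱⁿΛ(L) in Λ(L))`. -/
theorem theta_le_real_boxCrossing_zero (p : unitInterval) (L : ℕ) :
    theta (zdGraph d) (0 : Site d) p ≤ (bondPercolation (zdGraph d) p).real (boxCrossing d 0 L) := by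
  have h0 : percolatesAt (0 : Site d) ⊆ boxToInfinity d 0 := by
    intro ω hω
    exact ⟨0, mem_box.2 fun i => by simp, hω⟩
  calc theta (zdGraph d) (0 : Site d) p
      = (bondPercolation (zdGraph d) p).real (percolatesAt (0 : Site d)) := rfl
    _ ≤ (bondPercolation (zdGraph d) p).real (boxToInfinity d 0) := measureReal_mono h0
    _ ≤ (bondPercolation (zdGraph d) p).real (boxCrossing d 0 L) :=
        real_boxToInfinity_le_real_boxCrossing p (Nat.zero_le L)

/-! ## Symmetry: all `2d` centre-to-face events are alike -/

/-- A signed coordinate permutation maps `F_{k,ε}` onto `F_{k₀,+1}`. -/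
theorem real_centreToFace_eq (p : unitInterval) (L : ℕ) (k k₀ : Fin d) (ε : ℤˣ) :
    (bondPercolation (zdGraph d) p).real (centreToFace L k ε) =
      (bondPercolation (zdGraph d) p).real (centreToFace L k₀ 1) := by
  set φ : zdGraph d ≃g zdGraph d := zdSignedPermIso (Equiv.swap k k₀) (fun _ => ε) with hφ
  have key : ∀ x : Site d, (φ x) k₀ = (ε : ℤ) * x k := by
    intro x
    simp [hφ, Equiv.symm_swap, Equiv.swap_apply_right]
  have hbox : ∀ x : Site d, φ x ∈ box d L ↔ x ∈ box d L := fun x => by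
    simpa [hφ] using signedPerm_mem_box_iff (Equiv.swap k k₀) (fun _ => ε) (n := L) (x := x)
  have hBim : (φ.toEquiv : Site d ≃ Site d) '' (↑(box d L) : Set (Site d)) = ↑(box d L) :=
    image_eq_of_forall_iff φ.toEquiv fun x => by
      rw [Finset.mem_coe, Finset.mem_coe]
      exact (hbox x).symm
  have hFim : (φ.toEquiv : Site d ≃ Site d) '' cubeFace L k ε = cubeFace L k₀ 1 :=
    image_eq_of_forall_iff φ.toEquiv fun x => by
      simp only [cubeFace, Set.mem_setOf_eq, Units.val_one, one_mul]
      rw [show ((φ.toEquiv : Site d ≃ Site d) x) = φ x from rfl, hbox x, key x]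
  have hzero : φ 0 = 0 := by
    funext j
    have : (φ 0) j = (ε : ℤ) * (0 : Site d) ((Equiv.swap k k₀) j) := by
      simp [hφ]
    simpa using this
  have hZim : (φ.toEquiv : Site d ≃ Site d) '' ({0} : Set (Site d)) = {0} :=
    image_eq_of_forall_iff φ.toEquiv fun x => by
      simp only [Set.mem_singleton_iff]
      rw [show ((φ.toEquiv : Site d ≃ Site d) x) = φ x from rfl]
      constructor
      · rintro rfl; exact hzero
      · intro h
        exact φ.toEquiv.injective (h.trans hzero.symm)
  have himg := real_linked_image φ p (↑(box d L)) (cubeFace L k ε) {0}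
  rw [centreToFace, centreToFace, ← himg]
  change (bondPercolation (zdGraph d) p).real
      (linked ((φ.toEquiv : Site d ≃ Site d) '' ↑(box d L))
        ((φ.toEquiv : Site d ≃ Site d) '' cubeFace L k ε)
        ((φ.toEquiv : Site d ≃ Site d) '' {0})) = _
  rw [hBim, hFim, hZim]

/-! ## The square-root trick -/

/-- `(1 - P_p(F_{k₀,+1}))^{2d} ≤ 1 - θ(p)`: Harris–FKG for the `2d` decreasing events `F_{k,ε}ᶜ`,
whose intersection misses `{0 ↔ ∞}`. -/
theorem pow_compl_centreToFace_le (p : unitInterval) (L : ℕ) (k₀ : Fin d) :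
    (1 - (bondPercolation (zdGraph d) p).real (centreToFace L k₀ 1)) ^ (2 * d) ≤
      1 - theta (zdGraph d) (0 : Site d) p := by
  classical
  set μ := bondPercolation (zdGraph d) p with hμ
  let A : Fin d × ℤˣ → Set (BondConfig (Site d)) := fun q => (centreToFace L q.1 q.2)ᶜ
  have hAm : ∀ q ∈ (Finset.univ : Finset (Fin d × ℤˣ)), MeasurableSet (A q) :=
    fun q _ => (measurableSet_centreToFace L q.1 q.2).compl
  have hAl : ∀ q ∈ (Finset.univ : Finset (Fin d × ℤˣ)), IsLowerSet (A q) :=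
    fun q _ => (isUpperSet_centreToFace L q.1 q.2).compl
  have hAeq : ∀ q ∈ (Finset.univ : Finset (Fin d × ℤˣ)),
      μ.real (A q) = 1 - μ.real (centreToFace L k₀ 1) := by
    intro q _
    change μ.real (centreToFace L q.1 q.2)ᶜ = _
    rw [probReal_compl_eq_one_sub (measurableSet_centreToFace L q.1 q.2),
      real_centreToFace_eq p L q.1 k₀ q.2]
  have hprod : (1 - μ.real (centreToFace L k₀ 1)) ^ (2 * d) ≤
      μ.real (⋂ q ∈ (Finset.univ : Finset (Fin d × ℤˣ)), A q) := by
    calc (1 - μ.real (centreToFace L k₀ 1)) ^ (2 * d)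
        = ∏ _q ∈ (Finset.univ : Finset (Fin d × ℤˣ)), (1 - μ.real (centreToFace L k₀ 1)) := by
          rw [Finset.prod_const, Finset.card_univ, Fintype.card_prod, Fintype.card_fin,
            Fintype.card_units_int, mul_comm]
      _ = ∏ q ∈ (Finset.univ : Finset (Fin d × ℤˣ)), μ.real (A q) :=
          Finset.prod_congr rfl fun q hq => (hAeq q hq).symm
      _ ≤ μ.real (⋂ q ∈ (Finset.univ : Finset (Fin d × ℤˣ)), A q) :=
          prob_biInter_ge_prod_of_isLowerSet (zdGraph d) p _ A hAl hAm
  have hsub : (⋂ q ∈ (Finset.univ : Finset (Fin d × ℤˣ)), A q) ⊆ (boxCrossing d 0 L)ᶜ := by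
    intro ω hω hcross
    obtain ⟨k, hk⟩ := Set.mem_iUnion.1 (boxCrossing_zero_subset_iUnion_centreToFace L hcross)
    obtain ⟨ε, hε⟩ := Set.mem_iUnion.1 hk
    exact (Set.mem_iInter₂.1 hω) (k, ε) (Finset.mem_univ _) hε
  have hcompl : μ.real (boxCrossing d 0 L)ᶜ = 1 - μ.real (boxCrossing d 0 L) :=
    probReal_compl_eq_one_sub (measurableSet_boxCrossing 0 L)
  have hθ := theta_le_real_boxCrossing_zero (d := d) p L
  have := (hprod.trans (measureReal_mono hsub)).trans_eq hcompl
  rw [← hμ] at hθ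
  linarith

/-! ## Two opposite faces through the centre -/

/-- `F_{k,-1} ∩ F_{k,+1} ⊆ {face⁻ ↔ face⁺ in Λ(L)}`: both open paths pass through the centre. -/
theorem centreToFace_inter_subset_cubeCrossing (L : ℕ) (k : Fin d) :
    centreToFace L k (-1) ∩ centreToFace L k 1 ⊆ cubeCrossing (d := d) L k := by
  rintro ω ⟨h₁, h₂⟩
  rw [centreToFace, mem_linked_iff] at h₁ h₂
  obtain ⟨a, ha, b, hb, hab⟩ := h₁
  obtain ⟨a', ha', b', hb', hab'⟩ := h₂
  rw [Set.mem_singleton_iff] at hb hb'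
  subst hb; subst hb'
  rw [mem_inConn_iff] at hab hab'
  exact mem_linked_iff.2 ⟨a, ha, a', ha', mem_inConn_iff.2 (hab.trans hab'.symm)⟩

/-- `P_p(F_{k,+1})² ≤ P_p(Λ(L) crossed from face⁻ to face⁺)`: Harris for two increasing events and
the reflection symmetry `P(F_{k,-1}) = P(F_{k,+1})`. -/
theorem sq_centreToFace_le_cubeCrossing (p : unitInterval) (L : ℕ) (k : Fin d) :
    (bondPercolation (zdGraph d) p).real (centreToFace L k 1) ^ 2 ≤
      (bondPercolation (zdGraph d) p).real (cubeCrossing L k) := by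
  have hH := harris_fkg_holds (zdGraph d) p (isUpperSet_centreToFace L k (-1))
    (isUpperSet_centreToFace L k 1) (measurableSet_centreToFace L k (-1))
    (measurableSet_centreToFace L k 1)
  rw [real_centreToFace_eq p L k k (-1)] at hH
  calc (bondPercolation (zdGraph d) p).real (centreToFace L k 1) ^ 2
      = (bondPercolation (zdGraph d) p).real (centreToFace L k 1) *
          (bondPercolation (zdGraph d) p).real (centreToFace L k 1) := sq _
    _ ≤ (bondPercolation (zdGraph d) p).real (centreToFace L k (-1) ∩ centreToFace L k 1) := hH
    _ ≤ (bondPercolation (zdGraph d) p).real (cubeCrossing L k) :=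
        measureReal_mono (centreToFace_inter_subset_cubeCrossing L k)

/-! ## The bound -/

/-- **The exact cube is crossed whenever `θ(p) > 0`.** For every `p`, `L` and direction `k`:
`(1 - (1 - θ(p))^{1/(2d)})² ≤ P_p(Λ(L) is crossed inside itself from {x_k = -L} to {x_k = L})`. -/
theorem cubeCrossing_ge (p : unitInterval) (L : ℕ) (k : Fin d) :
    (1 - (1 - theta (zdGraph d) (0 : Site d) p) ^ (1 / (2 * d : ℝ))) ^ 2 ≤
      (bondPercolation (zdGraph d) p).real (cubeCrossing L k) := by
  have hd : (2 * d : ℕ) ≠ 0 := by have := k.pos; omega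
  set q := (bondPercolation (zdGraph d) p).real (centreToFace L k 1) with hq
  set t := theta (zdGraph d) (0 : Site d) p with ht
  have hq1 : q ≤ 1 := (measureReal_mono (Set.subset_univ _)).trans_eq probReal_univ
  have ht0 : 0 ≤ t := measureReal_nonneg
  have ht1 : t ≤ 1 := (measureReal_mono (Set.subset_univ _)).trans_eq probReal_univ
  have hpow := pow_compl_centreToFace_le (d := d) p L k
  rw [← hq, ← ht] at hpow
  have hexp : (1 / (2 * d : ℝ)) = ((2 * d : ℕ) : ℝ)⁻¹ := by push_cast; rw [one_div]
  -- `1 - q ≤ (1 - t)^{1/(2d)}`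
  have hroot : 1 - q ≤ (1 - t) ^ (1 / (2 * d : ℝ)) := by
    have h1 : (1 - q) = ((1 - q) ^ (2 * d)) ^ (1 / (2 * d : ℝ)) := by
      rw [hexp, Real.pow_rpow_inv_natCast (by linarith) hd]
    rw [h1]
    exact Real.rpow_le_rpow (by positivity) hpow (by positivity)
  have hle1 : (1 - t) ^ (1 / (2 * d : ℝ)) ≤ 1 :=
    Real.rpow_le_one (by linarith) (by linarith) (by positivity)
  have hq0 : 0 ≤ 1 - (1 - t) ^ (1 / (2 * d : ℝ)) := by linarith
  calc (1 - (1 - t) ^ (1 / (2 * d : ℝ))) ^ 2 ≤ q ^ 2 :=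
        pow_le_pow_left₀ hq0 (by linarith) 2
    _ ≤ (bondPercolation (zdGraph d) p).real (cubeCrossing L k) :=
        sq_centreToFace_le_cubeCrossing p L k

/-- **In the jump world the critical cube is crossed face to face, uniformly in `L`.** If
`θ(p_c) > 0` on `ℤ^d` then for some `c₀ > 0`, every `L` and every direction `k`,
`P_{p_c}(Λ(L) crossed inside itself from {x_k = -L} to {x_k = L}) ≥ c₀`. -/
theorem cubeCrossing_ge_of_not_continuity (hd : 1 ≤ d) (h : ¬ PercolationContinuity d) :
    ∃ c₀ : ℝ, 0 < c₀ ∧ ∀ (L : ℕ) (k : Fin d),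
      c₀ ≤ (bondPercolation (zdGraph d) (criticalProbI d)).real (cubeCrossing L k) := by
  set t := theta (zdGraph d) (0 : Site d) (criticalProbI d) with ht
  have ht0 : 0 < t := by
    have hne : t ≠ 0 := fun h0 => h (by rw [PercolationContinuity]; exact h0)
    exact lt_of_le_of_ne measureReal_nonneg (Ne.symm hne)
  have ht1 : t ≤ 1 := (measureReal_mono (Set.subset_univ _)).trans_eq probReal_univ
  refine ⟨(1 - (1 - t) ^ (1 / (2 * d : ℝ))) ^ 2, ?_, fun L k => cubeCrossing_ge _ L k⟩
  have hlt : (1 - t) ^ (1 / (2 * d : ℝ)) < 1 :=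
    Real.rpow_lt_one (by linarith) (by linarith) (by positivity)
  have : 0 < 1 - (1 - t) ^ (1 / (2 * d : ℝ)) := by linarith
  positivity

/-- The `ℤ³` instance: if `θ(p_c(ℤ³)) > 0` then every cube `Λ(L)` is crossed face to opposite face
inside itself at `p_c` with probability at least some `c₀ > 0` independent of `L`. -/
theorem cubeCrossing_ge_of_not_continuityZ3 (h : ¬ PercolationContinuityZ3) :
    ∃ c₀ : ℝ, 0 < c₀ ∧ ∀ (L : ℕ) (k : Fin 3),
      c₀ ≤ (bondPercolation (zdGraph 3) (criticalProbI 3)).real (cubeCrossing L k) :=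
  cubeCrossing_ge_of_not_continuity (d := 3) (by norm_num) h

end SurfaceTension

end Summit.CriticalPhenomena.PercolationContinuityZ3.Theorems
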